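import Literature.AnabelianGeometry.SemiGraphs.TemperedPiOrbit
import Literature.AnabelianGeometry.SemiGraphs.TemperedPiTrees
import Literature.AnabelianGeometry.SemiGraphs.TemperedPiSystemSurj
import Literature.AnabelianGeometry.SemiGraphs.TemperedPiExistence
import Literature.AnabelianGeometry.SemiGraphs.TemperedResiduallyFiniteHolds
import Literature.AnabelianGeometry.SemiGraphs.UniversalCoveringOverAutDescent
import Literature.AnabelianGeometry.SemiGraphs.UniversalCoveringOverTransitive
import Literature.AnabelianGeometry.SemiGraphs.GaloisApproxProofs
import Literature.AnabelianGeometry.SemiGraphs.OrbitGraphFinite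
import Literature.GroupTheory.CombinatorialGroupTheory.FreeGroupoidFiniteRank
import Literature.GroupTheory.CombinatorialGroupTheory.FreeGroupCommutingPowers
import HarnessLib

/-!
# The virtually free tower of `π₁^temp(𝒢)`: the André tower input `htower₀` AT THE MODEL

Mochizuki, *Semi-graphs of anabelioids*, Publ. RIMS **42** (2006) [SemiAnbd], §3 p. 38 (proof of
Prop. 3.6): "`𝒢_{∞,i} → 𝒢` is Galois with `Gal(𝒢_{∞,i}/𝒢_i) ≅ π₁(𝔾_i)` [a free group] of finite
index in `Gal(𝒢_{∞,i}/𝒢)` … `π₁^temp(𝒢) := lim_i Gal(𝒢_{∞,i}/𝒢)`"; p. 39 "an extension of a finite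
group by a free group"; Y. André, *On a geometric description of `Gal(Q̄_p/Q_p)` and a p-adic
avatar of `GT^`*, Duke Math. J. 119 (2003), §4.5 (tempered fundamental groups are inverse limits of
virtually free groups).  [cite: MochizukiSemiAnbd2006, Prop 3.6 p.38]

PROOF-ONLY file (abc-iut cell, prover abc-iut-w5-d139; no definitions, no named facts).  Every
kernel discharge of [SemiAnbd] §6 in the tree (Lem. 6.1 (ii)(iii), 6.3 (ii)(iii), Thm. 6.4, 6.6;
files `TemperedAnabelian*OfTowerProofs`, `TemperedDeltaTower`, `TemperedCommensurablyTerminal`)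
and of [EtTh] Lem. 2.17 (ii) consumes ONE structural input on a tempered group `Π`:

  `htower₀ : ∀ U ∈ 𝓝 (1 : Π), ∃ N : OpenNormalSubgroup Π, (N : Set Π) ⊆ U ∧
      ∃ (G : Subgroup (Π ⧸ N.toSubgroup)) (_ : IsFreeGroup G), G.Normal ∧ G.FiniteIndex ∧
        Finite (IsFreeGroup.Generators G) ∧ ∃ a ∈ G, ∃ b ∈ G, a * b ≠ b * a`

This file PROVES that statement for the tree's construction `π₁^temp(𝒢) := lim_n Gal(𝒢_{∞,n}/𝒢)`
(`GaloisLevelData.temperedPi`, `ProfiniteSemiGraph.temperedPi`) from results already in the tree: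
the kernels `ker ρ_n` of the surjective projections `ρ_n : π₁^temp(𝒢) → G_n := Aut(𝒢_{∞,S n})`
are open and cofinal (`proj_surjective`, `isOpen_ker_proj`, `exists_ker_proj_subset`), so
`π₁^temp/ker ρ_n ≅ G_n`; the free-by-finite exact sequence `1 → π₁(𝔾_{S n}, [x_n]) → G_n → Aut(S n)`
(`CovObj.deckHom_injective`, `range_deckHom_eq_ker`, `finite_aut_of_rigid`); and the finite rank of
`π₁` of a finite connected graph (`FreeGroupoidFiniteRank.lean`).

Main results:
* `GaloisLevelData.temperedPi_tower` — for any Galois level data `D` whose levels have fibre-rigid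
  endomorphisms, finite base fibres, free deck groups of finite rank, and NON-ABELIAN deck groups
  at cofinally many levels, `π₁^temp(𝒢)` (for `D`) satisfies `htower₀`;
* `ProfiniteSemiGraph.temperedPi_tower` — the same for THE model `𝒢.temperedPi h36` of
  Prop. 3.6 (i)(ii) over a semi-graph of anabelioids with finitely many edges, the rigidity,
  finiteness, connectedness and finite-rank inputs being DISCHARGED (`hrigid_ofBObj_of_isConnected`,
  `ofBObj_isFinite`, `sameComponent_ofBObj_of_isConnected`, `FreeGroupoidFiniteRank`); the one
  remaining hypothesis is the non-abelianness of `π₁(𝔾_n, [x_n])` at ONE level `n` (first Betti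
  number `≥ 2` somewhere in the tower; it climbs the tower by `deckGroup_not_commute_of_le` — a
  property of the graph of anabelioids, e.g. of the curve it comes from, not a structural input).

Honest scope: this is the graph-of-anabelioids level ([SemiAnbd] §3); the curve-level `htower₀` for
`Π^temp_{X_K}` (Ex. 3.10 / §6) needs a construction of `Π^temp_{X_K}` from such charts (not here).
Nothing here concerns the disputed parts of IUT or takes a side on [IUTchIII] Cor. 3.12.
-/

noncomputable section

namespace Literature.AnabelianGeometry.SemiGraphs

namespace ProfiniteSemiGraph

open CategoryTheory
open _root_.Topology
open Literature.GroupTheory.CombinatorialGroupTheory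

universe u

variable {𝒢 : ProfiniteSemiGraph.{u}}

/-! ### Free-by-finite groups: transporting the deck sequence through an isomorphism -/

section Algebra

variable {P K A Q : Type u} [Group P] [Group K] [Group A] [Group Q]

/-- **Free-by-finite transport.** Let `d : K →* A` be injective with free domain of finite rank,
`φ : A →* Q` with finite codomain and `range d = ker φ`, and `e : P ≃* A`.  Then the pull-back
`G := (range d).comap e` is a free, normal, finite-index subgroup of `P` with finitely many free
generators, and it is non-abelian as soon as `K` is ([SemiAnbd] p. 39: "an extension of a finite
group by a free group"). [cite: MochizukiSemiAnbd2006, Prop 3.6(iii) p.39] -/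
theorem exists_free_normal_finiteIndex_of_free_by_finite [Finite Q] (d : K →* A) (φ : A →* Q)
    (hd : Function.Injective d) (hexact : d.range = φ.ker)
    (hK : ∃ _ : IsFreeGroup K, Finite (IsFreeGroup.Generators K))
    (hab : ∃ a b : K, a * b ≠ b * a) (e : P ≃* A) :
    ∃ (G : Subgroup P) (_ : IsFreeGroup G), G.Normal ∧ G.FiniteIndex ∧
      Finite (IsFreeGroup.Generators G) ∧ ∃ a ∈ G, ∃ b ∈ G, a * b ≠ b * a := by
  classical
  -- the subgroup: pull back `range d = ker φ` along `e`
  let G : Subgroup P := φ.ker.comap e.toMonoidHom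
  have hGker : G = (φ.comp e.toMonoidHom).ker := MonoidHom.comap_ker φ e.toMonoidHom
  -- normal, of finite index (the quotient embeds in the finite group `Q`)
  have hnormal : G.Normal := by rw [hGker]; infer_instance
  have hfi : G.FiniteIndex := by
    rw [hGker]
    haveI : Finite (P ⧸ (φ.comp e.toMonoidHom).ker) :=
      Finite.of_equiv _ (QuotientGroup.quotientKerEquivRange (φ.comp e.toMonoidHom)).symm.toEquiv
    exact Subgroup.finiteIndex_of_finite_quotient
  -- `G ≅ K`: `x ↦ d⁻¹ (e x)`
  have hmemG : ∀ {x : P}, x ∈ G ↔ e x ∈ d.range := by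
    intro x
    rw [hexact]
    rfl
  let iK : K ≃* d.range := MonoidHom.ofInjective hd
  let f : G → K := fun x => iK.symm ⟨e x, hmemG.mp x.2⟩
  have hf_spec : ∀ x : G, d (f x) = e x := fun x => by
    have h1 : ((iK (f x) : d.range) : A) = d (f x) := MonoidHom.ofInjective_apply hd
    have h2 : iK (f x) = ⟨e x, hmemG.mp x.2⟩ := MulEquiv.apply_symm_apply iK _
    rw [← h1, h2]
  have hf_mul : ∀ x y : G, f (x * y) = f x * f y := fun x y => hd (by
    rw [map_mul, hf_spec, hf_spec, hf_spec, Subgroup.coe_mul, map_mul])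
  have hf_bij : Function.Bijective f := by
    constructor
    · intro x y hxy
      apply Subtype.ext
      apply e.injective
      rw [← hf_spec, ← hf_spec, hxy]
    · intro k
      refine ⟨⟨e.symm (d k), hmemG.mpr (by rw [MulEquiv.apply_symm_apply]; exact ⟨k, rfl⟩)⟩, hd ?_⟩
      rw [hf_spec]
      exact e.apply_symm_apply _
  let eGK : G ≃* K := { Equiv.ofBijective f hf_bij with map_mul' := hf_mul }
  -- freeness and finite rank transport along `eGK.symm`
  obtain ⟨hfree, hfin⟩ :=
    IsFreeGroup.exists_isFreeGroup_finite_generators_of_mulEquiv eGK.symm hK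
  -- non-abelianness
  obtain ⟨a, b, hab⟩ := hab
  refine ⟨G, hfree, hnormal, hfi, hfin, (eGK.symm a : G), (eGK.symm a).2, (eGK.symm b : G),
    (eGK.symm b).2, fun h => hab ?_⟩
  have h' : eGK.symm a * eGK.symm b = eGK.symm b * eGK.symm a := Subtype.ext h
  rw [← map_mul, ← map_mul] at h'
  exact eGK.symm.injective h'

/-- **Non-abelianness climbs a surjection of free-by-finite groups.**  Let `s : A' →* A` be
surjective, `K ≤ A` a free, finite-index subgroup containing two non-commuting elements, and
`K' ≤ A'` a finite-index subgroup.  Then `K'` contains two non-commuting elements: otherwise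
`s(K')` would be an abelian subgroup of finite index of `A`, and `s(K') ∩ K` an abelian subgroup of
finite index of the non-abelian free group `K` — impossible (a finite-index subgroup of a
non-abelian free group is non-abelian, `exists_not_commute_of_finiteIndex_of_isFreeGroup`).
[cite: LyndonSchupp2001, Ch. I Prop. 2.17] -/
theorem exists_not_commute_of_surjective_of_finiteIndex {A' : Type u} [Group A'] (s : A' →* A)
    (hs : Function.Surjective s) (K : Subgroup A) [K.FiniteIndex] (hKfree : IsFreeGroup K)
    (hab : ∃ a ∈ K, ∃ b ∈ K, a * b ≠ b * a) (K' : Subgroup A') [K'.FiniteIndex] :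
    ∃ a ∈ K', ∃ b ∈ K', a * b ≠ b * a := by
  by_contra hcomm
  have hcomm' : ∀ a ∈ K', ∀ b ∈ K', a * b = b * a := fun a ha b hb => by
    by_contra hne
    exact hcomm ⟨a, ha, b, hb, hne⟩
  -- `H := s(K')`, abelian of finite index in `A`
  let H : Subgroup A := K'.map s
  haveI hH : H.FiniteIndex := by
    refine ⟨fun h0 => ?_⟩
    have hdvd : H.index ∣ K'.index := Subgroup.index_map_dvd K' hs
    rw [h0, zero_dvd_iff] at hdvd
    exact Subgroup.FiniteIndex.index_ne_zero hdvd
  have hHcomm : ∀ x ∈ H, ∀ y ∈ H, x * y = y * x := by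
    rintro _ ⟨x, hx, rfl⟩ _ ⟨y, hy, rfl⟩
    rw [← map_mul, ← map_mul, hcomm' x hx y hy]
  -- `L := (H ⊓ K) ∩ K ≤ K`, of finite index in the free group `K`
  let L : Subgroup K := (H ⊓ K).subgroupOf K
  haveI hL : L.FiniteIndex := inferInstance
  -- two non-commuting elements of `K`, as elements of the free group `↥K`
  obtain ⟨a, ha, b, hb, hab⟩ := hab
  have hab' : (⟨a, ha⟩ : K) * ⟨b, hb⟩ ≠ ⟨b, hb⟩ * ⟨a, ha⟩ := fun h =>
    hab (by simpa using congrArg Subtype.val h)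
  haveI := hKfree
  obtain ⟨x, hx, y, hy, hxy⟩ := exists_not_commute_of_finiteIndex_of_isFreeGroup hab' L
  exact hxy (Subtype.ext (hHcomm x.1 (Subgroup.mem_subgroupOf.mp hx).1 y.1
    (Subgroup.mem_subgroupOf.mp hy).1))

end Algebra

/-! ### The tower for general Galois level data -/

namespace GaloisLevelData

variable (D : GaloisLevelData 𝒢) (h𝒢 : 𝒢.IsCountable)

/-- **The virtually free tower of `π₁^temp(𝒢) = lim_n Gal(𝒢_{∞,n}/𝒢)`** (André's tower property,
[André 2003] §4.5; [SemiAnbd] pp. 38–39): if the endomorphisms of every level `S n` are determined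
by their value at the base point (`hrigid`), the base fibres are finite (`hfin`), the deck groups
`π₁(𝔾_{S n}, [x_n])` are free of finite rank (`hrank`) and non-abelian for cofinally many `n`
(`hnonab`), then the open normal subgroups `ker ρ_n` are cofinal in `𝓝 1` and
`π₁^temp/ker ρ_n ≅ Gal(𝒢_{∞,n}/𝒢)` contains the free, normal, finite-index, finite-rank,
non-abelian subgroup `Gal(𝒢_{∞,n}/𝒢_n) ≅ π₁(𝔾_{S n})` — VERBATIM the input `htower₀` of the
tree's [SemiAnbd] §6 discharges. [cite: MochizukiSemiAnbd2006, Prop 3.6 p.38] -/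
theorem temperedPi_tower
    (hrigid : ∀ n (σ σ' : D.S n ⟶ D.S n),
      (σ.fV D.v₀).hom.hom (D.x n) = (σ'.fV D.v₀).hom.hom (D.x n) → σ = σ')
    (hfin : ∀ n, Finite (((D.S n).SV D.v₀).obj.V))
    (hrank : ∀ n, ∃ _ : IsFreeGroup ((D.S n).orbitGraph.FundamentalGroup ((D.S n).baseComp D.v₀ (D.x n))),
      Finite (IsFreeGroup.Generators ((D.S n).orbitGraph.FundamentalGroup ((D.S n).baseComp D.v₀ (D.x n)))))
    (hnonab : ∀ n₀ : ℕ, ∃ n, n₀ ≤ n ∧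
      ∃ a b : (D.S n).orbitGraph.FundamentalGroup ((D.S n).baseComp D.v₀ (D.x n)), a * b ≠ b * a) :
    ∀ U ∈ 𝓝 (1 : D.temperedPi h𝒢), ∃ N : OpenNormalSubgroup (D.temperedPi h𝒢),
      (N : Set (D.temperedPi h𝒢)) ⊆ U ∧
      ∃ (G : Subgroup (D.temperedPi h𝒢 ⧸ N.toSubgroup)) (_ : IsFreeGroup G), G.Normal ∧
        G.FiniteIndex ∧ Finite (IsFreeGroup.Generators G) ∧ ∃ a ∈ G, ∃ b ∈ G, a * b ≠ b * a := by
  intro U hU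
  -- a level `n₀` whose kernel lies in `U`, then a level `n ≥ n₀` with non-abelian deck group
  obtain ⟨n₀, hn₀⟩ := D.exists_ker_proj_subset h𝒢 hU
  obtain ⟨n, hn, hab⟩ := hnonab n₀
  -- the open normal subgroup `ker ρ_n`
  let N : OpenNormalSubgroup (D.temperedPi h𝒢) :=
    { toSubgroup := (D.proj h𝒢 n).ker
      isOpen' := D.isOpen_ker_proj h𝒢 n }
  refine ⟨N, fun γ hγ => hn₀ γ ?_, ?_⟩
  · -- `ρ_{n₀} = mapLE ∘ ρ_n` kills `ker ρ_n`
    have hγ' : D.proj h𝒢 n γ = 1 := hγ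
    rw [← D.mapLE_proj h𝒢 hn γ, hγ', map_one]
  · -- `π₁^temp / ker ρ_n ≅ G_n = Aut(𝒢_{∞,n})`, and the deck sequence of level `n`
    let F : CovObj 𝒢 := D.S n
    have htrans : ∀ x : (F.SV D.v₀).obj.V, ∃ σ : F ⟶ F, (σ.fV D.v₀).hom.hom (D.x n) = x :=
      fun x => D.htrans n D.v₀ (D.x n) x
    haveI : Finite ((F.SV D.v₀).obj.V) := hfin n
    haveI : Finite (Aut F) := CovObj.finite_aut_of_rigid F D.v₀ (D.x n) (hrigid n)
    let e : D.temperedPi h𝒢 ⧸ N.toSubgroup ≃* D.Gal h𝒢 n :=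
      QuotientGroup.quotientKerEquivOfSurjective (D.proj h𝒢 n) (D.proj_surjective h𝒢 n)
    exact exists_free_normal_finiteIndex_of_free_by_finite
      (CovObj.deckHom F D.v₀ (D.x n) h𝒢)
      (CovObj.autDescendHom F D.v₀ (D.x n) h𝒢 htrans (hrigid n))
      (CovObj.deckHom_injective F D.v₀ (D.x n) h𝒢)
      (CovObj.range_deckHom_eq_ker F D.v₀ (D.x n) h𝒢 htrans (hrigid n))
      (hrank n) hab e

/-- **Non-abelianness climbs the Galois tower.**  If every level has fibre-rigid endomorphisms and
finite base fibre, and the deck group `π₁(𝔾_{S n}, [x_n])` of level `n` is non-abelian, then so is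
the deck group of level `n + 1`: apply `exists_not_commute_of_surjective_of_finiteIndex` to the
surjection `Gal(𝒢_{∞,n+1}/𝒢) ↠ Gal(𝒢_{∞,n}/𝒢)` (`step_surjective`) and the free finite-index deck
subgroups (`deckHom`, `range_deckHom_eq_ker`, `finite_aut_of_rigid`).
[cite: MochizukiSemiAnbd2006, Prop 3.6 p.38] -/
theorem deckGroup_not_commute_succ (h𝒢 : 𝒢.IsCountable)
    (hrigid : ∀ n (σ σ' : D.S n ⟶ D.S n),
      (σ.fV D.v₀).hom.hom (D.x n) = (σ'.fV D.v₀).hom.hom (D.x n) → σ = σ')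
    (hfin : ∀ n, Finite (((D.S n).SV D.v₀).obj.V)) (n : ℕ)
    (hab : ∃ a b : (D.S n).orbitGraph.FundamentalGroup ((D.S n).baseComp D.v₀ (D.x n)),
      a * b ≠ b * a) :
    ∃ a b : (D.S (n + 1)).orbitGraph.FundamentalGroup ((D.S (n + 1)).baseComp D.v₀ (D.x (n + 1))), a * b ≠ b * a := by
  -- level `n`: the free finite-index deck subgroup `K ≤ G_n = Aut(𝒢_{∞,n})`
  let F : CovObj 𝒢 := D.S n
  have htrans : ∀ x : (F.SV D.v₀).obj.V, ∃ σ : F ⟶ F, (σ.fV D.v₀).hom.hom (D.x n) = x :=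
    fun x => D.htrans n D.v₀ (D.x n) x
  haveI : Finite ((F.SV D.v₀).obj.V) := hfin n
  haveI : Finite (Aut F) := CovObj.finite_aut_of_rigid F D.v₀ (D.x n) (hrigid n)
  let d := CovObj.deckHom F D.v₀ (D.x n) h𝒢
  have hd : Function.Injective d := CovObj.deckHom_injective F D.v₀ (D.x n) h𝒢
  let φ := CovObj.autDescendHom F D.v₀ (D.x n) h𝒢 htrans (hrigid n)
  let K := d.range
  have hK : K = φ.ker := CovObj.range_deckHom_eq_ker F D.v₀ (D.x n) h𝒢 htrans (hrigid n)
  haveI : K.FiniteIndex := by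
    rw [hK]
    haveI := Finite.of_equiv _ (QuotientGroup.quotientKerEquivRange φ).symm.toEquiv
    exact Subgroup.finiteIndex_of_finite_quotient
  have hKfree : IsFreeGroup K := by
    haveI := SemiGraph.isFreeGroup_fundamentalGroup F.orbitGraph (F.baseComp D.v₀ (D.x n))
    exact IsFreeGroup.ofMulEquiv (MonoidHom.ofInjective hd)
  have habK : ∃ a ∈ K, ∃ b ∈ K, a * b ≠ b * a := by
    obtain ⟨a, b, hab⟩ := hab
    refine ⟨d a, ⟨a, rfl⟩, d b, ⟨b, rfl⟩, fun h => hab (hd ?_)⟩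
    rw [map_mul, map_mul]
    exact h
  -- level `n + 1`: the finite-index deck subgroup `K' ≤ G_{n+1}`
  let F' : CovObj 𝒢 := D.S (n + 1)
  have htrans' : ∀ x : (F'.SV D.v₀).obj.V, ∃ σ : F' ⟶ F', (σ.fV D.v₀).hom.hom (D.x (n + 1)) = x :=
    fun x => D.htrans (n + 1) D.v₀ (D.x (n + 1)) x
  haveI : Finite ((F'.SV D.v₀).obj.V) := hfin (n + 1)
  haveI : Finite (Aut F') := CovObj.finite_aut_of_rigid F' D.v₀ (D.x (n + 1)) (hrigid (n + 1))
  let d' := CovObj.deckHom F' D.v₀ (D.x (n + 1)) h𝒢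
  have hd' : Function.Injective d' := CovObj.deckHom_injective F' D.v₀ (D.x (n + 1)) h𝒢
  let φ' := CovObj.autDescendHom F' D.v₀ (D.x (n + 1)) h𝒢 htrans' (hrigid (n + 1))
  let K' := d'.range
  have hK' : K' = φ'.ker :=
    CovObj.range_deckHom_eq_ker F' D.v₀ (D.x (n + 1)) h𝒢 htrans' (hrigid (n + 1))
  haveI : K'.FiniteIndex := by
    rw [hK']
    haveI := Finite.of_equiv _ (QuotientGroup.quotientKerEquivRange φ').symm.toEquiv
    exact Subgroup.finiteIndex_of_finite_quotient
  -- climb along the surjection `step : G_{n+1} ↠ G_n` (typed on the `Aut` groups)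
  let s : Aut (F'.univCoverOver (F'.baseComp D.v₀ (D.x (n + 1))) h𝒢) →*
      Aut (F.univCoverOver (F.baseComp D.v₀ (D.x n)) h𝒢) := D.step h𝒢 n
  have hs : Function.Surjective s := D.step_surjective h𝒢 n
  obtain ⟨a', ha', b', hb', hab'⟩ :=
    exists_not_commute_of_surjective_of_finiteIndex s hs K hKfree habK K'
  obtain ⟨a, rfl⟩ := ha'
  obtain ⟨b, rfl⟩ := hb'
  refine ⟨a, b, fun h => hab' ?_⟩
  rw [← map_mul, ← map_mul, h]

/-- Non-abelianness of the deck group at one level propagates to every higher level.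
[cite: MochizukiSemiAnbd2006, Prop 3.6 p.38] -/
theorem deckGroup_not_commute_of_le (h𝒢 : 𝒢.IsCountable)
    (hrigid : ∀ n (σ σ' : D.S n ⟶ D.S n),
      (σ.fV D.v₀).hom.hom (D.x n) = (σ'.fV D.v₀).hom.hom (D.x n) → σ = σ')
    (hfin : ∀ n, Finite (((D.S n).SV D.v₀).obj.V)) {n₁ n : ℕ} (h : n₁ ≤ n)
    (hab : ∃ a b : (D.S n₁).orbitGraph.FundamentalGroup ((D.S n₁).baseComp D.v₀ (D.x n₁)),
      a * b ≠ b * a) :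
    ∃ a b : (D.S n).orbitGraph.FundamentalGroup ((D.S n).baseComp D.v₀ (D.x n)), a * b ≠ b * a := by
  induction h with
  | refl => exact hab
  | step _ ih => exact D.deckGroup_not_commute_succ h𝒢 hrigid hfin _ ih

/-- **The virtually free tower of `π₁^temp(𝒢)`, with the non-abelianness hypothesis at ONE level**:
as `temperedPi_tower`, assuming only that the deck group of SOME level `n₁` is non-abelian
(`deckGroup_not_commute_of_le` propagates it up the tower). [cite: MochizukiSemiAnbd2006, Prop 3.6 p.38] -/
theorem temperedPi_tower_of_exists
    (hrigid : ∀ n (σ σ' : D.S n ⟶ D.S n),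
      (σ.fV D.v₀).hom.hom (D.x n) = (σ'.fV D.v₀).hom.hom (D.x n) → σ = σ')
    (hfin : ∀ n, Finite (((D.S n).SV D.v₀).obj.V))
    (hrank : ∀ n, ∃ _ : IsFreeGroup ((D.S n).orbitGraph.FundamentalGroup ((D.S n).baseComp D.v₀ (D.x n))),
      Finite (IsFreeGroup.Generators ((D.S n).orbitGraph.FundamentalGroup ((D.S n).baseComp D.v₀ (D.x n)))))
    (hnonab : ∃ (n₁ : ℕ) (a b : (D.S n₁).orbitGraph.FundamentalGroup ((D.S n₁).baseComp D.v₀ (D.x n₁))),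
      a * b ≠ b * a) :
    ∀ U ∈ 𝓝 (1 : D.temperedPi h𝒢), ∃ N : OpenNormalSubgroup (D.temperedPi h𝒢),
      (N : Set (D.temperedPi h𝒢)) ⊆ U ∧
      ∃ (G : Subgroup (D.temperedPi h𝒢 ⧸ N.toSubgroup)) (_ : IsFreeGroup G), G.Normal ∧
        G.FiniteIndex ∧ Finite (IsFreeGroup.Generators G) ∧ ∃ a ∈ G, ∃ b ∈ G, a * b ≠ b * a := by
  obtain ⟨n₁, a, b, hab⟩ := hnonab
  exact D.temperedPi_tower h𝒢 hrigid hfin hrank fun n₀ =>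
    ⟨max n₀ n₁, le_max_left _ _,
      D.deckGroup_not_commute_of_le h𝒢 hrigid hfin (le_max_right n₀ n₁) ⟨a, b, hab⟩⟩

end GaloisLevelData

/-! ### The tower AT THE MODEL `𝒢.temperedPi h36` of Prop. 3.6 (i)(ii) -/
section Model

variable (𝒢 : ProfiniteSemiGraph.{u}) (h36 : 𝒢.Prop36Hypotheses)

/-- Every component (vertex- or edge-orbit) of the graph `𝔾_n` of the `n`-th Galois level is
reachable from the base component in the fundamental groupoid (the levels are CONNECTED finite
étale Galois coverings). [cite: MochizukiSemiAnbd2006, Prop 3.6 p.38] -/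
theorem galoisLevelData_nonempty_hom_baseComp (n : ℕ)
    (a : ((𝒢.galoisLevelData h36).S n).orbitGraph.CatCarrier) :
    Nonempty (((𝒢.galoisLevelData h36).S n).orbitGraph.basept
        (((𝒢.galoisLevelData h36).S n).baseComp (𝒢.galoisLevelData h36).v₀
          ((𝒢.galoisLevelData h36).x n)) ⟶
      ((𝒢.galoisLevelData h36).S n).orbitGraph.basept a) := by
  let S : CovObj 𝒢 := (𝒢.galoisLevelData h36).S n
  letI := 𝒢.toAnab.galoisCategory_bObj ⟨h36.isConnected⟩
  have hconn : ∀ p q : S.Point, S.SameComponent p q := fun p q =>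
    𝒢.sameComponent_ofBObj_of_isConnected h36.isConnected (𝒢.tower h36 n)
      (𝒢.isGalois_tower h36 n).toIsConnected p q
  -- every component is the node of a point
  have hnode : ∃ q : S.Point, S.pointNode q = a := by
    rcases a with V | E
    · obtain ⟨x, hx⟩ := CovObj.OVertex.exists_rep S V
      exact ⟨Sum.inl ⟨_, x⟩, congrArg Sum.inl hx⟩
    · obtain ⟨y, hy⟩ := CovObj.OEdge.exists_rep S E
      exact ⟨Sum.inr ⟨_, y⟩, congrArg Sum.inr hy⟩
  obtain ⟨q, rfl⟩ := hnode
  exact S.nonempty_hom_of_sameComponent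
    (hconn (Sum.inl ⟨(𝒢.galoisLevelData h36).v₀, (𝒢.galoisLevelData h36).x n⟩) q)

/-- **The deck groups of the model tower are free of finite rank**: `π₁(𝔾_n, [x_n])` for the graph
`𝔾_n` of the `n`-th Galois level over a semi-graph of anabelioids with finitely many edges.
[cite: MochizukiSemiAnbd2006, Prop 3.6 p.38] -/
theorem galoisLevelData_deckGroup_finite_rank [Finite 𝒢.graph.Edge] (n : ℕ) :
    ∃ _ : IsFreeGroup (((𝒢.galoisLevelData h36).S n).orbitGraph.FundamentalGroup
      (((𝒢.galoisLevelData h36).S n).baseComp (𝒢.galoisLevelData h36).v₀ ((𝒢.galoisLevelData h36).x n))),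
      Finite (IsFreeGroup.Generators (((𝒢.galoisLevelData h36).S n).orbitGraph.FundamentalGroup
      (((𝒢.galoisLevelData h36).S n).baseComp (𝒢.galoisLevelData h36).v₀ ((𝒢.galoisLevelData h36).x n)))) := by
  haveI : Finite ((𝒢.galoisLevelData h36).S n).orbitGraph.Branch :=
    CovObj.finite_orbitGraph_branch _ (𝒢.ofBObj_isFinite (𝒢.tower h36 n))
  exact SemiGraph.exists_isFreeGroup_finite_generators_fundamentalGroup _ _
    (𝒢.galoisLevelData_nonempty_hom_baseComp h36 n)

/-- **[SemiAnbd] Prop. 3.6 / [André 2003] §4.5 AT THE MODEL: the virtually free tower of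
`π₁^temp(𝒢)`.**  For a semi-graph of anabelioids `𝒢` satisfying the hypotheses of Prop. 3.6 with
finitely many edges, ONE of whose Galois levels has a non-abelian graph fundamental group
`π₁(𝔾_n, [x_n])` (equivalently `b₁(𝔾_n) ≥ 2`; it then holds at all higher levels), the constructed
tempered fundamental group `𝒢.temperedPi h36` satisfies the
tower property `htower₀`: cofinal open normal subgroups `N = ker ρ_n` with `π₁^temp/N` containing
a free, normal, finite-index, finite-rank, non-abelian subgroup.  Rigidity, finiteness,
connectedness and finite rank of the levels are THEOREMS here (`hrigid_ofBObj_of_isConnected`,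
`ofBObj_isFinite`, `sameComponent_ofBObj_of_isConnected`, `FreeGroupoidFiniteRank`).
[cite: MochizukiSemiAnbd2006, Prop 3.6(i) p.38] -/
theorem temperedPi_tower [Finite 𝒢.graph.Edge]
    (hnonab : ∃ (n : ℕ) (a b : ((𝒢.galoisLevelData h36).S n).orbitGraph.FundamentalGroup
      (((𝒢.galoisLevelData h36).S n).baseComp (𝒢.galoisLevelData h36).v₀ ((𝒢.galoisLevelData h36).x n))), a * b ≠ b * a) :
    ∀ U ∈ 𝓝 (1 : 𝒢.temperedPi h36), ∃ N : OpenNormalSubgroup (𝒢.temperedPi h36),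
      (N : Set (𝒢.temperedPi h36)) ⊆ U ∧
      ∃ (G : Subgroup (𝒢.temperedPi h36 ⧸ N.toSubgroup)) (_ : IsFreeGroup G), G.Normal ∧
        G.FiniteIndex ∧ Finite (IsFreeGroup.Generators G) ∧ ∃ a ∈ G, ∃ b ∈ G, a * b ≠ b * a := by
  letI := 𝒢.toAnab.galoisCategory_bObj ⟨h36.isConnected⟩
  exact (𝒢.galoisLevelData h36).temperedPi_tower_of_exists h36.isCountable
    (fun n σ σ' h => 𝒢.hrigid_ofBObj_of_isConnected h36.isConnected _
      (𝒢.isGalois_tower h36 n).toIsConnected _ _ σ σ' h)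
    (fun n => (𝒢.ofBObj_isFinite (𝒢.tower h36 n)).finite_V _)
    (𝒢.galoisLevelData_deckGroup_finite_rank h36)
    hnonab

end Model

end ProfiniteSemiGraph

end Literature.AnabelianGeometry.SemiGraphs

end
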